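import Summits.Ventures.PercRepro.C025ProfileAll

/-!
# C-032 «PROFILE (Π)» — the level-wise form (R1) at `q = 1` for EVERY finite matroid (night-3 g6)

`c025_levelwise_q_one`: for every finite matroid, every `p` and every `1 ≤ u ≤ p`,
`C(p+1, u) · #{A ⊆ E : ρ(A) = p, ρ(E∖A) = 1} ≤ (p+1) · #{S ⊆ E : ρ(S) = u}` — the level-wise (R1) of C-025 at
`(p, 1)`, in the set-builder vocabulary of `RankLevelSetB.c025_levelwise_q_one_of_simple`, now without the simplicity
hypothesis: it is the term `ρ(E∖B) = p` of the row `q = 1` of `(Π)` (`profileIneq_one_all`) read through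
`Profile.card_Uq_mul_le_card_Lq` and the counting bridges `PerFlat.ncard_U_le_card_Uq`, `ThmH.ncard_family_eq_card`.
-/

open scoped Matroid

namespace PercRepro

open Set Finset ThmH

variable {α : Type} [DecidableEq α] {M : Matroid α} [M.Finite]

omit [DecidableEq α] in
/-- The level count as a set-builder cardinality: `#{S ⊆ E : ρ(S) = u} = #levelSet M u`. -/
theorem ncard_level_eq_card_levelSet (u : ℕ) :
    {S : Set α | S ⊆ M.E ∧ M.eRk S = (u : ℕ∞)}.ncard = (Shadow.levelSet M u).card := by
  classical
  rw [ThmH.ncard_family_eq_card M (fun S => M.eRk S = (u : ℕ∞))]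
  congr 1

/-- **Level-wise (R1) at `q = 1` for every finite matroid**: `C(p+1,u)·#U(p,1) ≤ (p+1)·W_u` for `1 ≤ u ≤ p`. -/
theorem c025_levelwise_q_one (p u : ℕ) (hu1 : 1 ≤ u) (hup : u ≤ p) :
    (p + 1).choose u *
      {A : Set α | A ⊆ M.E ∧ M.eRk A = (p : ℕ∞) ∧ M.eRk (M.E \ A) = ((1 : ℕ) : ℕ∞)}.ncard ≤
      (p + 1) * {S : Set α | S ⊆ M.E ∧ M.eRk S = (u : ℕ∞)}.ncard := by
  have h := Profile.card_Uq_mul_le_card_Lq (M := M) (p := p) (q := 1) hup (profileIneq_one_all M u hu1)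
  have hU := PerFlat.ncard_U_le_card_Uq M p 1
  rw [ncard_level_eq_card_levelSet]
  have hc1 : (Nat.choose (p + 1) 1 : ℚ) = (p : ℚ) + 1 := by rw [Nat.choose_one_right]; push_cast; ring
  rw [hc1] at h
  have hpos : (0 : ℚ) < (p : ℚ) + 1 := by positivity
  rw [← mul_div_assoc, div_le_iff₀ hpos] at h
  have hmain : ((p + 1).choose u : ℚ) *
      ({A : Set α | A ⊆ M.E ∧ M.eRk A = (p : ℕ∞) ∧ M.eRk (M.E \ A) = ((1 : ℕ) : ℕ∞)}.ncard : ℚ) ≤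
      ((p : ℚ) + 1) * ((Shadow.levelSet M u).card : ℚ) := by
    calc ((p + 1).choose u : ℚ) *
          ({A : Set α | A ⊆ M.E ∧ M.eRk A = (p : ℕ∞) ∧ M.eRk (M.E \ A) = ((1 : ℕ) : ℕ∞)}.ncard : ℚ)
        ≤ ((p + 1).choose u : ℚ) * ((PerFlat.Uq M p 1).card : ℚ) :=
          mul_le_mul_of_nonneg_left (by exact_mod_cast hU) (by positivity)
      _ = ((PerFlat.Uq M p 1).card : ℚ) * ((p + 1).choose u : ℚ) := mul_comm _ _
      _ ≤ ((Shadow.levelSet M u).card : ℚ) * ((p : ℚ) + 1) := h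
      _ = ((p : ℚ) + 1) * ((Shadow.levelSet M u).card : ℚ) := mul_comm _ _
  exact_mod_cast hmain

end PercRepro
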